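import Summits.QuantumFields.YangMills.Theorems.SoloBlindStrongCouplingRung
import Literature.MathematicalPhysics.QuantumFieldTheory.UniformTorusClusteringProofs
import Literature.MathematicalPhysics.QuantumFieldTheory.LatticeGaugeProofs

/-!
# Line `momentum-pincer` (crux `IR`, stmt-QuantumFields-19354): rung R1 — β-UNIFORM strong-coupling clustering (`NoLightMoversSC`) — PROVED

Route `BalabanLadder`, crux `IR`, line `momentum-pincer` (ideator ym-ir-idea-5, skeleton `Cruxes/IR/Lines/momentum_pincer.lean`,
stub `stub_noLightMoversSC : NoLightMoversSC`, rung R1 of `Cruxes/IR/Lines/momentum-pincer-rungs.md`), pooled prover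
`ym-ir-line-bsf-p1` (director-ym R366 pooled queue).

* `torusClustering_uniform_fixedRate` — the Osterwalder–Seiler torus clustering with constants uniform in the volume AND
  IN THE COUPLING on the window `0 ≤ β ≤ β₀ := r/e`, `r = betaOne d ρ / 2`: rate `1` per lattice site and a constant
  `C(F₁, F₂)` that does not depend on `β` (the tree's `osterwalder_seiler_torusClustering_uniform_holds` exports
  `C = K e^{m(β)(R₁+R₂+2)}` with `m(β) = log(r/β) → ∞`, so its TYPE gives no β-uniformity; here the same replica /
  polymer bound `PlaqSystem.norm_truncatedExpect_le` is run with the FIXED mass `1`, using `(β/r)^n ≤ e^{−n}` for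
  `β ≤ r/e`).
* `noLightMoversSC_holds` — the line's rung `NoLightMoversSC` VERBATIM (body only uses tree declarations):
  `∀ G simple, ∀ r, ∃ β₀ c > 0, ∀ A B : YMSpecies G, ∃ C, ∀ β ∈ (0, β₀], ∀ S, ∀ t ≤ S,
  |latticeConnectedCorr r.ρ β (2S+1) A.F B.F t| ≤ C e^{−c t}` (with `c = 1`); the skeleton closes its stub by
  `theorem stub_noLightMoversSC : NoLightMoversSC := noLightMoversSC_holds` (definitional unfolding only).

Honest framing: strong coupling only, group-blind (simplicity of `G` is not used); exercises the line's format where the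
dispersion relation is computable; nothing here bears on weak coupling, `IR`, or the Yang–Mills mass gap (Clay).  R4 of
the ladder closes only the conditional finite-𝕋⁴ rung `BalabanLadder.UV`.
Refs: K. Osterwalder, E. Seiler, Ann. Phys. 110 (1978) 440, Thm. 3.5 with Remark (3.9); line card
`Cruxes/IR/Lines/momentum-pincer.md`, rung plan `Cruxes/IR/Lines/momentum-pincer-rungs.md`.
-/

set_option autoImplicit false

namespace Summit.QuantumFields.YangMills.Cruxes.IR.MomentumPincerRung

open MeasureTheory Finset Filter Topology
open Literature.MathematicalPhysics.QuantumFieldTheory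
open Literature.MathematicalPhysics.QuantumLattice (configShift configShift_apply toTorusObservable
  IsCylinder IsLocalObservable LGConfig)
open Literature.Probability.LatticeModels (Torus.proj Torus.proj_apply)
open Literature.Probability.LatticeModels.Site (supNorm supNorm_le_iff natAbs_le_supNorm
  exists_natAbs_eq_supNorm norm_eq_supNorm)

noncomputable section

/-! ## §1 Torus clustering with constants uniform in the volume and in the coupling -/

section Main

variable {d N : ℕ} {G : Type} [Group G] [TopologicalSpace G] [IsTopologicalGroup G]
  [CompactSpace G] [MeasurableSpace G] [BorelSpace G] (ρ : G →* Matrix (Fin N) (Fin N) ℂ)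

/-- `(β / r)^n ≤ e^{−n}` on the window `0 ≤ β ≤ r / e`. -/
theorem pow_div_le_exp_neg_of_le {β r : ℝ} (hβ : 0 ≤ β) (hr : 0 < r) (hβr : β ≤ r / Real.exp 1) (n : ℕ) :
    (β / r) ^ n ≤ Real.exp (-(n : ℝ)) := by
  have h1 : β / r ≤ Real.exp (-1) := by
    rw [div_le_iff₀ hr, Real.exp_neg, inv_mul_eq_div]
    exact hβr
  calc (β / r) ^ n ≤ (Real.exp (-1)) ^ n := pow_le_pow_left₀ (div_nonneg hβ hr.le) h1 n
    _ = Real.exp (-(n : ℝ)) := by rw [← Real.exp_nat_mul]; ring_nf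

/-- **Osterwalder–Seiler torus clustering, uniform in the volume, the displacement AND the coupling** (fixed rate `1`
per site on the strong-coupling window `0 ≤ β ≤ r/e`, `r = betaOne d ρ / 2`): for local bounded measurable `F₁, F₂`
there is ONE constant `C` with `|⟨F₁ (F₂∘θ_x)⟩ − ⟨F₁⟩⟨F₂∘θ_x⟩| ≤ C e^{−‖x‖}` on every torus of side `L + 1 > 2‖x‖` and
every `β` in the window. -/
theorem torusClustering_uniform_fixedRate (hd : 2 ≤ d) (hρ : Continuous ρ) :
    ∃ β₀ : ℝ, 0 < β₀ ∧ ∀ F₁ F₂ : LGConfig d G → ℝ,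
      Literature.MathematicalPhysics.QuantumLattice.IsLocalObservable F₁ →
      Literature.MathematicalPhysics.QuantumLattice.IsLocalObservable F₂ →
      Measurable F₁ → Measurable F₂ → (∃ C, ∀ U, |F₁ U| ≤ C) → (∃ C, ∀ U, |F₂ U| ≤ C) →
        ∃ C : ℝ, ∀ β : ℝ, 0 ≤ β → β ≤ β₀ →
          ∀ (L : ℕ) (x : Literature.Probability.LatticeModels.Site d), 2 * ‖x‖ < (L : ℝ) + 1 →
            |wilsonExpectation (L := L + 1) ρ β
                  (toTorusObservable (L + 1) fun U => F₁ U * F₂ (configShift x U)) -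
                wilsonExpectation (L := L + 1) ρ β (toTorusObservable (L + 1) F₁) *
                  wilsonExpectation (L := L + 1) ρ β
                    (toTorusObservable (L + 1) (F₂ ∘ configShift x))| ≤
              C * Real.exp (-‖x‖) := by
  classical
  haveI : NeZero d := ⟨by omega⟩
  -- the strong-coupling radius and the window
  set r : ℝ := betaOne d ρ / 2 with hrdef
  have hr : 0 < r := by have := betaOne_pos d (ρ := ρ); positivity
  have hrR : r < betaOne d ρ := by have := betaOne_pos d (ρ := ρ); rw [hrdef]; linarith
  refine ⟨r / Real.exp 1, by positivity, fun F₁ F₂ hloc₁ hloc₂ h₁m h₂m hb₁ hb₂ => ?_⟩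
  obtain ⟨B₁, hB₁⟩ := hloc₁
  obtain ⟨S₂, hS₂⟩ := hloc₂
  obtain ⟨C₁, hC₁⟩ := hb₁
  obtain ⟨C₂, hC₂⟩ := hb₂
  have hC₁0 : 0 ≤ C₁ := (abs_nonneg _).trans (hC₁ fun _ => 1)
  have hC₂0 : 0 ≤ C₂ := (abs_nonneg _).trans (hC₂ fun _ => 1)
  -- the constants (β-independent)
  set c : ℕ := bondRadius B₁ + bondRadius S₂ + 2 with hcdef
  set sB : ℕ := (B₁.card + S₂.card) * (2 ^ d * (d * d)) with hsB
  set κ : ℝ := 2 * Real.exp (1 / 2) with hκ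
  have hκ1 : 1 ≤ κ := by
    rw [hκ]; have := Real.one_lt_exp_iff.2 (by norm_num : (0 : ℝ) < 1 / 2); linarith
  set Kunif : ℝ := C₁ * C₂ * κ ^ sB + C₁ * κ ^ sB * (C₂ * κ ^ sB) with hKunif
  have hKunif0 : 0 ≤ Kunif := by positivity
  refine ⟨Kunif * Real.exp c, fun β hβ0 hβw L x hx => ?_⟩
  have hβr : β ≤ r := hβw.trans (div_le_self hr.le (Real.one_le_exp_iff.2 zero_le_one))
  -- the torus system of side `L + 1`
  set L' : ℕ := L + 1 with hL'
  have hR : (torusSystem (d := d) (G := G) ρ L').Regular (costBound ρ) (Plaq.degBound d) :=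
    torusSystem_regular ρ hρ
  set X₀ : ℕ := supNorm x with hX₀
  have hxn : ‖x‖ = (X₀ : ℝ) := norm_eq_supNorm x
  have hx' : 2 * X₀ < L' := by
    have h : (2 : ℝ) * X₀ < (L : ℝ) + 1 := by rwa [hxn] at hx
    exact_mod_cast h
  -- the twisted observables
  set Φ₁ : ZdGaugeConfig d G → ℂ := fun U => (F₁ (U ∘ torusRed L') : ℂ) with hΦ₁
  set Φ₂ : ZdGaugeConfig d G → ℂ := fun U => (F₂ (configShift x (U ∘ torusRed L')) : ℂ) with hΦ₂
  set B₂ : Finset (ZdEdge d) := S₂.image fun e => (e.1 - x, e.2) with hB₂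
  have hΦ₁m : Measurable Φ₁ :=
    Complex.measurable_ofReal.comp (h₁m.comp (measurable_comp_relabel (torusRed L')))
  have hΦ₂m : Measurable Φ₂ :=
    Complex.measurable_ofReal.comp ((h₂m.comp (configShift x).measurable).comp
      (measurable_comp_relabel (torusRed L')))
  have hΦ₁b : ∀ U, ‖Φ₁ U‖ ≤ C₁ := fun U => by
    rw [hΦ₁, Complex.norm_real, Real.norm_eq_abs]; exact hC₁ _
  have hΦ₂b : ∀ U, ‖Φ₂ U‖ ≤ C₂ := fun U => by
    rw [hΦ₂, Complex.norm_real, Real.norm_eq_abs]; exact hC₂ _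
  have hΦ₁d : DependsOn Φ₁ ((B₁.image (torusRed L') : Finset (ZdEdge d)) : Set (ZdEdge d)) :=
    dependsOn_comp_torusRed L' (F := fun U => (F₁ U : ℂ)) fun U V h => by
      show (F₁ U : ℂ) = F₁ V; rw [hB₁ h]
  have hΦ₂d : DependsOn Φ₂ ((B₂.image (torusRed L') : Finset (ZdEdge d)) : Set (ZdEdge d)) := by
    have h := IsCylinder.comp_configShift hS₂ x
    exact dependsOn_comp_torusRed L' (F := fun U => ((F₂ ∘ configShift x) U : ℂ)) fun U V h' => by
      show (((F₂ ∘ configShift x) U : ℝ) : ℂ) = ((F₂ ∘ configShift x) V : ℝ); rw [h h']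
  -- step 1: the real truncated correlation is dominated by the complex one
  refine (abs_truncated_le_norm_expect ρ hρ β L' h₁m h₂m hC₁ hC₂ x).trans ?_
  change ‖(torusSystem ρ L').expect (fun U => Φ₁ U * Φ₂ U) (torusGenuine d L') β -
      (torusSystem ρ L').expect Φ₁ (torusGenuine d L') β *
        (torusSystem ρ L').expect Φ₂ (torusGenuine d L') β‖ ≤ Kunif * Real.exp c * Real.exp (-‖x‖)
  -- seed counts, uniformly in `L` and `x`
  have hs₁ : ((torusSystem (G := G) ρ L').seedsOf (B₁.image (torusRed L'))).card ≤ sB := by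
    refine (card_seedsOf_torusSystem_le ρ B₁).trans ((card_seedsOf_le_mul B₁).trans ?_)
    rw [hsB]; exact Nat.mul_le_mul_right _ (Nat.le_add_right _ _)
  have hB₂c : B₂.card ≤ S₂.card := Finset.card_image_le
  have hs₂ : ((torusSystem (G := G) ρ L').seedsOf (B₂.image (torusRed L'))).card ≤ sB := by
    refine (card_seedsOf_torusSystem_le ρ B₂).trans ((card_seedsOf_le_mul B₂).trans ?_)
    rw [hsB]; exact Nat.mul_le_mul_right _ (hB₂c.trans (Nat.le_add_left _ _))
  have hs₁₂ : ((torusSystem (G := G) ρ L').seedsOf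
      (B₁.image (torusRed L') ∪ B₂.image (torusRed L'))).card ≤ sB := by
    rw [← Finset.image_union]
    refine (card_seedsOf_torusSystem_le ρ _).trans ((card_seedsOf_le_mul _).trans ?_)
    rw [hsB]
    exact Nat.mul_le_mul_right _ ((Finset.card_union_le _ _).trans (Nat.add_le_add_left hB₂c _))
  have hK : C₁ * C₂ * κ ^ ((torusSystem (G := G) ρ L').seedsOf
        (B₁.image (torusRed L') ∪ B₂.image (torusRed L'))).card +
      C₁ * κ ^ ((torusSystem (G := G) ρ L').seedsOf (B₁.image (torusRed L'))).card *
        (C₂ * κ ^ ((torusSystem (G := G) ρ L').seedsOf (B₂.image (torusRed L'))).card) ≤ Kunif := by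
    rw [hKunif]
    refine add_le_add (mul_le_mul_of_nonneg_left (pow_le_pow_right₀ hκ1 hs₁₂) (by positivity))
      (mul_le_mul (mul_le_mul_of_nonneg_left (pow_le_pow_right₀ hκ1 hs₁) hC₁0)
        (mul_le_mul_of_nonneg_left (pow_le_pow_right₀ hκ1 hs₂) hC₂0) (by positivity)
        (by positivity))
  -- the coupling in the disc
  have hβn : ‖(β : ℂ)‖ ≤ r := by
    rw [Complex.norm_real, Real.norm_eq_abs, abs_of_nonneg hβ0]; exact hβr
  have hβR : ‖(β : ℂ)‖ ≤ PlaqSystem.betaR (costBound ρ) (Plaq.degBound d) := by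
    rw [betaR_costBound]; exact hβn.trans hrR.le
  have hexp : Real.exp c * Real.exp (-‖x‖) = Real.exp (c - X₀) := by
    rw [← Real.exp_add, hxn]; ring_nf
  by_cases hfar : c < X₀
  · -- far displacements: disjoint supports, long joining polymers
    have hdisj : Disjoint (B₁.image (torusRed L')) (B₂.image (torusRed L')) :=
      disjoint_image_torusRed (by rw [hcdef] at hfar; omega) hx'
    have hn : ∀ Q, Q ⊆ torusGenuine d L' →
        (torusSystem (G := G) ρ L').Joins Q (B₁.image (torusRed L')) (B₂.image (torusRed L')) →
        X₀ - c ≤ Q.card := by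
      intro Q _ hJ
      have h := PlaqSystem.le_card_of_joins (S := torusSystem (G := G) ρ L')
        (fun p => tdist L' originPlaq p)
        (fun u v huv => tdist_le_of_tadj originPlaq ((torusSystem_adj_iff ρ).1 huv))
        (a := bondRadius B₁ + 1) (b := X₀ - bondRadius S₂ - 1)
        (fun p hp => by
          obtain ⟨y, rfl, hy⟩ := (touches_torusSystem_iff ρ B₁ p).1 hp
          exact tdist_le_of_touches hy)
        (fun q hq => by
          obtain ⟨y, rfl, hy⟩ := (touches_torusSystem_iff ρ B₂ q).1 hq
          exact le_tdist_of_touches_shift hy hx') hJ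
      rw [hcdef]; omega
    have hbound := PlaqSystem.norm_truncatedExpect_le hR hΦ₁m hΦ₂m hΦ₁b hΦ₂b hΦ₁d hΦ₂d hdisj
      (torusGenuine d L') hn hr (by rwa [betaR_costBound]) hβn
    refine hbound.trans ?_
    have hdec := pow_div_le_exp_neg_of_le hβ0 hr hβw (X₀ - c)
    rw [Complex.norm_real, Real.norm_eq_abs, abs_of_nonneg hβ0] at *
    calc _ ≤ Kunif * Real.exp (-((X₀ - c : ℕ) : ℝ)) :=
          mul_le_mul hK hdec (by positivity) hKunif0
      _ = Kunif * Real.exp c * Real.exp (-‖x‖) := by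
          rw [mul_assoc, hexp, Nat.cast_sub hfar.le]; ring_nf
  · -- near displacements: the crude bound
    push Not at hfar
    have hbound := PlaqSystem.norm_truncatedExpect_le_const hR hβR hΦ₁m hΦ₂m hΦ₁b hΦ₂b hΦ₁d hΦ₂d
      (torusGenuine d L')
    refine (hbound.trans hK).trans ?_
    rw [mul_assoc, hexp]
    have h1 : (1 : ℝ) ≤ Real.exp (c - X₀) := by
      refine Real.one_le_exp_iff.2 ?_
      have : (X₀ : ℝ) ≤ c := by exact_mod_cast hfar
      linarith
    nlinarith

end Main

/-! ## §2 The rung of line `momentum-pincer` -/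

/-- **R1 — `NoLightMoversSC` (PROVED): β-uniform strong-coupling clustering of every pair of species** on all odd tori,
at rate `1` per lattice site, with ONE constant `C(A, B)` on the whole window `0 < β ≤ β₀(G, r)`.  VERBATIM the body
of `Summit.QuantumFields.YangMills.Cruxes.IR.MomentumPincer.NoLightMoversSC` (simplicity of `G` is carried, not used). -/
theorem noLightMoversSC_holds :
    ∀ (G : Type) [Group G] [TopologicalSpace G] [IsTopologicalGroup G] [CompactSpace G],
      IsCompactSimpleLieGroup G → letI : MeasurableSpace G := borel G; haveI : BorelSpace G := ⟨rfl⟩;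
      ∀ r : LatticeRep G, ∃ β₀ c : ℝ, 0 < β₀ ∧ 0 < c ∧
        ∀ A B : YMSpecies G, ∃ C : ℝ, ∀ β : ℝ, 0 < β → β ≤ β₀ → ∀ S t : ℕ, t ≤ S →
          |latticeConnectedCorr r.ρ β (2 * S + 1) A.F B.F t| ≤ C * Real.exp (-(c * t)) := by
  intro G _ _ _ _ _
  letI : MeasurableSpace G := borel G
  haveI : BorelSpace G := ⟨rfl⟩
  intro r
  haveI : SecondCountableTopology G :=
    (r.continuous.isClosedEmbedding r.injective).isEmbedding.secondCountableTopology
  haveI : T2Space G := (r.continuous.isClosedEmbedding r.injective).isEmbedding.t2Space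
  have hd : 2 ≤ 4 := by norm_num
  obtain ⟨β₀, hβ₀, h⟩ := torusClustering_uniform_fixedRate (d := 4) r.ρ hd r.continuous
  refine ⟨β₀, 1, hβ₀, one_pos, fun A B => ?_⟩
  obtain ⟨C, hC⟩ := h A.F B.F ⟨A.supp, A.isCylinder⟩ ⟨B.supp, B.isCylinder⟩ A.measurable
    B.measurable A.bounded B.bounded
  refine ⟨C, fun β hβ hββ₀ S t ht => ?_⟩
  have htS : (t : ℝ) ≤ S := by exact_mod_cast ht
  have key := hC β hβ.le hββ₀ (2 * S) (-Pi.single (0 : Fin 4) (t : ℤ))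
  rw [norm_neg, Pi.norm_single, Int.norm_natCast, toTorusObservable_comp_configShift,
    wilsonExpectation_comp_torusConfigShift,
    ← Summit.QuantumFields.YangMills.Theorems.SoloBlind.latticeConnectedCorr_eq_wilsonExpectation] at key
  simpa [one_mul] using key (by push_cast; linarith)

end

end Summit.QuantumFields.YangMills.Cruxes.IR.MomentumPincerRung
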